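import Literature.NumberTheory.LFunctions.DoubleLargeSieve
import Literature.NumberTheory.Sieve.BoundedGapsNumberFieldsProofs
import HarnessLib

/-!
# The additive large sieve inequality for a totally real number field (Huxley; Hinz)

Topic `Literature/NumberTheory/Sieve`; namespace `Literature.NumberTheory.Sieve.NumberFieldLS`.
Everything in this file is PROVED (theorems; the definitions have bodies; no named facts).

**The printed results.** M. N. Huxley, *The large sieve inequality for algebraic number fields*,
Mathematika 15 (1968), 178–187, Theorem 1: for a number field `K` of degree `n`, complex numbers
`c(α)` attached to the integers `α` of a "box" `ℜ` (`|α^{(k)}| ≤ N_k^{1/2}`-type conditions at the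
archimedean places, `N = ∏ N_k`), and the additive characters `α ↦ e(Tr(κα))` of `𝓞_K/𝔮`,
`κ ∈ 𝔮⁻¹𝔡⁻¹/𝔡⁻¹` of exact denominator `𝔮` (`𝔡` the different),
`∑_{N𝔮 ≤ Q} ∑_{κ} |∑_α c(α) e(Tr κα)|² ≪ (N + Q²) ∑ |c(α)|²`.  J. G. Hinz, *Methoden des großen Siebes
in algebraischen Zahlkörpern*, Manuscripta Math. 57 (1987), 181–194 (quoted as (3.1) of J. G. Hinz,
*A generalization of Bombieri's prime number theorem to algebraic number fields*, Acta Arith. 51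
(1988), 173–193) refines this for coefficients supported on a nonzero ideal `𝔞`: the factor becomes
`Q² + N/N𝔞`.

**What is proved here** (totally real `K`, degree `d`, real Minkowski coordinates
`ι = {w // w.IsReal}`, `remb x = (σ_w x)_w`):

* `discreteLargeSieve_of_neighbours` — the abstract *discrete large sieve from the double large
  sieve* in `ℝ^ι`: for finite families of points `x_p` (`|x_{p,k}| ≤ X_k`) and `y_q` (`|y_{q,k}| ≤ Y_k`)
  such that every `x_p` has at most `A` members of the `x`-family in the box of half-sides `1/(2Y_k)`
  around it and every `y_q` at most `B` members of the `y`-family within `1/(2X_k)`,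
  `∑_q |∑_p a_p e(x_p · y_q)|² ≤ 624^{#ι} ∏_k (1 + X_k Y_k) · A · B · ∑_p |a_p|²`
  (the tree's `Literature.NumberTheory.LFunctions.DoubleLargeSieve.doubleLargeSieve`,
  Bombieri–Iwaniec / Graham–Kolesnik Lemma 7.5, plus duality and the bound
  `𝓝(b; δ) ≤ (max # neighbours) ∑|b|²` of the weighted neighbour count);
* the geometry of numbers of ideal lattices of a totally real field in the sup-norm:
  `trace_eq_sum_remb` (`Tr = ∑_w σ_w`), `abs_norm_eq_prod_abs_remb` / `exists_rpow_le_abs_remb`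
  (an element of norm `≥ η` in absolute value has a coordinate `≥ η^{1/d}`),
  `card_filter_close_le_of_separated` (a `δ`-separated family has at most `∏_k (2ρ_k/δ + 2)`
  members in a box of half-sides `ρ_k`), `card_filter_ideal_close_le` (points of `𝔞` are
  `N𝔞^{1/d}`-separated), `exists_short_mem_inv` (a balanced short vector `b ∈ 𝔞⁻¹`, all
  `|σ_w b| ≤ c N𝔞^{-1/d}`, from the tree's Minkowski lemma
  `CastilloEtAl2015.exists_ne_zero_mem_ideal_forall_lt` applied to the integral ideal `N𝔞 · 𝔞⁻¹`),
  `exists_mem_inv_remb_sub_le` (every point of `ℝ^ι` is within `C_K N𝔞^{-1/d}` of `remb(𝔞⁻¹)`),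
  `e_trace_mul_add_of_mem_inv` (`e(Tr(α(κ+λ))) = e(Tr(ακ))` for `α ∈ 𝔞`, `λ ∈ 𝔞⁻¹`);
* **`additiveLargeSieve`** — the additive large sieve over `K` in Hinz's sublattice form: there is
  `C_K` such that for every nonzero ideal `𝔞`, every finite `S ⊆ 𝔞` lying in a box of half-sides
  `X_k > 0` (centre arbitrary), every `δ > 0` and every finite family `(κ_r)` of elements of `K` which
  is `δ`-separated modulo `𝔞⁻¹` in the sup-norm (`‖remb(κ_r − κ_{r'} − λ)‖_∞ ≥ δ` for `r ≠ r'`,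
  `λ ∈ 𝔞⁻¹` — for the additive characters of `𝓞_K/𝔮` restricted to `𝔞` this is the spacing of the
  "Farey points" of `K`, supplied by the sequel), and all coefficients `c`,
  `∑_r |∑_{α ∈ S} c(α) e(Tr(α κ_r))|² ≤ C_K ∏_k [(1 + X_k N𝔞^{-1/d})(1 + (δ X_k)⁻¹)] ∑_{α∈S} |c(α)|²`.
  For a cube (`X_k = X₀`) and the separation `δ = (T N𝔞)^{-1/d}` the factor is
  `≪_K (1 + X₀^d/N𝔞)(1 + TN𝔞/X₀^d)` (`additiveLargeSieve_cube`); with the Farey spacing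
  `T = Q²|d_K|` and `N𝔞 ≤ X₀^d` this is `≪_K Q² + X₀^d/N𝔞` — Huxley's Theorem 1 for `𝔞 = 𝓞_K`
  and Hinz's (3.1) in its additive form.

The passage to multiplicative characters (Gauss sums, `∑_{N𝔮≤Q} (N𝔮/φ(𝔮)) ∑*_χ`) is the sequel file.

## Proof sketch (a deviation from the printed proofs, recorded here)

Huxley argues with a several-variable Gallagher/Bombieri–Davenport inequality, Hinz with Selberg's
method. We use the double large sieve of the tree instead: writing `e(Tr(ακ)) = e(remb α · remb κ)`
(totally real: `Tr = ∑_w σ_w`), `|∑_α∑_r a(α)b(r)e(x_α·y_r)|² ≤ 624^d ∏(1 + X_kY_k) 𝓝(a)𝓝(b)` with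
`x_α = remb α − centre` and `y_r` a representative of `κ_r` modulo `𝔞⁻¹` of sup-norm
`≤ Y_k = C_K N𝔞^{-1/d}` (translating `κ_r` by `λ ∈ 𝔞⁻¹` does not change the character on `S ⊆ 𝔞`).
Points of `𝔞` are `N𝔞^{1/d}`-separated in the sup-norm (`|N(α − α')| ≥ N𝔞`), so `𝓝(a) ≤ 3^d ∑|a|²`;
the `y_r` are `δ`-separated, so `𝓝(b) ≤ ∏(2 + (δX_k)⁻¹) ∑|b|²`; duality turns the bilinear bound into
the stated mean square bound.

## References

* M. N. Huxley, *The large sieve inequality for algebraic number fields*, Mathematika 15 (1968),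
  178–187, Theorem 1. [Huxley1968]
* J. G. Hinz, *Methoden des großen Siebes in algebraischen Zahlkörpern*, Manuscripta Math. 57 (1987),
  181–194; quoted as (3.1) in J. G. Hinz, Acta Arith. 51 (1988), 173–193, §3. [Hinz1987] [Hinz1988]
* S. W. Graham, G. Kolesnik, *Van der Corput's Method of Exponential Sums*, LMS LN 126 (1991),
  Lemma 7.5 (the double large sieve). [GrahamKolesnik1991]

## Mathlib / tree search

Tree: `DoubleLargeSieve.doubleLargeSieve`, `neighbourCount` (`LFunctions/DoubleLargeSieve.lean`);
`CastilloEtAl2015.exists_ne_zero_mem_ideal_forall_lt`, `le_apply_of_forall_lt`,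
`absNorm_le_abs_norm_of_mem`, `realEmb` (`Sieve/BoundedGapsNumberFieldsProofs.lean`);
`LFunctions.NumberField.trace_eq_sum_mult_mul_re` (trace through the places; re-proved here in the
totally real form to keep the import closure small). Mathlib: `InfinitePlace.prod_eq_abs_norm`,
`IsTotallyReal.mult_eq`, `trace_eq_sum_embeddings`, `Ideal.absNorm_mem`, `FractionalIdeal`.
`lean search 'largeSieve.*NumberField|Huxley.*sieve|additiveLargeSieve'`: nothing for number fields.
-/

noncomputable section

open Complex Finset NumberField NumberField.InfinitePlace
open scoped Real ComplexConjugate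

namespace Literature.NumberTheory.Sieve.NumberFieldLS

open Literature.NumberTheory.LFunctions.VdC (e norm_e e_add e_zero e_neg)
open Literature.NumberTheory.LFunctions.DoubleLargeSieve (neighbourCount neighbourCount_nonneg
  doubleLargeSieve)

/-! ## The discrete large sieve from the double large sieve (any finite dimension) -/

section Discrete

variable {ι : Type*} [Fintype ι] {α β : Type*}

/-- **Weighted neighbour count versus the maximal number of neighbours**: if every point of the
family has at most `M` members of the family (itself included) in the box of half-sides `δ_k` around
it, then `𝓝(b; δ) ≤ M ∑_q |b_q|²` (from `|b_q||b_{q'}| ≤ (|b_q|² + |b_{q'}|²)/2` and the symmetry of the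
closeness relation). [folklore] -/
theorem neighbourCount_le_of_card_le (s : Finset β) (y : β → ι → ℝ) (b : β → ℂ)
    (δ : ι → ℝ) {M : ℝ}
    (hM : ∀ q ∈ s, ((s.filter fun q' => ∀ k, |y q k - y q' k| ≤ δ k).card : ℝ) ≤ M) :
    neighbourCount s y b δ ≤ M * ∑ q ∈ s, ‖b q‖ ^ 2 := by
  classical
  unfold neighbourCount
  -- bound each term by the average of squares
  have h1 : ∑ q ∈ s, ∑ q' ∈ s, (if ∀ k, |y q k - y q' k| ≤ δ k then ‖b q‖ * ‖b q'‖ else 0) ≤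
      ∑ q ∈ s, ∑ q' ∈ s, (if ∀ k, |y q k - y q' k| ≤ δ k then (‖b q‖ ^ 2 + ‖b q'‖ ^ 2) / 2 else 0) := by
    refine Finset.sum_le_sum fun q _ => Finset.sum_le_sum fun q' _ => ?_
    split_ifs
    · nlinarith [sq_nonneg (‖b q‖ - ‖b q'‖)]
    · exact le_rfl
  refine h1.trans ?_
  -- split the symmetric sum into its two halves
  have hsymm : ∀ q q', (∀ k, |y q k - y q' k| ≤ δ k) ↔ (∀ k, |y q' k - y q k| ≤ δ k) := by
    intro q q'
    exact forall_congr' fun k => by rw [abs_sub_comm]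
  have h2 : ∑ q ∈ s, ∑ q' ∈ s, (if ∀ k, |y q k - y q' k| ≤ δ k then (‖b q‖ ^ 2 + ‖b q'‖ ^ 2) / 2 else 0) =
      ∑ q ∈ s, ∑ q' ∈ s, (if ∀ k, |y q k - y q' k| ≤ δ k then ‖b q‖ ^ 2 / 2 else 0) +
        ∑ q ∈ s, ∑ q' ∈ s, (if ∀ k, |y q k - y q' k| ≤ δ k then ‖b q'‖ ^ 2 / 2 else 0) := by
    rw [← Finset.sum_add_distrib]
    refine Finset.sum_congr rfl fun q _ => ?_
    rw [← Finset.sum_add_distrib]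
    refine Finset.sum_congr rfl fun q' _ => ?_
    split_ifs <;> ring
  have h3 : ∑ q ∈ s, ∑ q' ∈ s, (if ∀ k, |y q k - y q' k| ≤ δ k then ‖b q'‖ ^ 2 / 2 else 0) =
      ∑ q ∈ s, ∑ q' ∈ s, (if ∀ k, |y q k - y q' k| ≤ δ k then ‖b q‖ ^ 2 / 2 else 0) := by
    rw [Finset.sum_comm]
    refine Finset.sum_congr rfl fun q _ => Finset.sum_congr rfl fun q' _ => ?_
    rw [if_congr (hsymm q' q) rfl rfl]
  rw [h2, h3, ← two_mul]
  -- evaluate the half sums through the neighbour cardinalities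
  have h4 : ∀ q ∈ s, ∑ q' ∈ s, (if ∀ k, |y q k - y q' k| ≤ δ k then ‖b q‖ ^ 2 / 2 else 0) ≤
      M * (‖b q‖ ^ 2 / 2) := by
    intro q hq
    rw [← Finset.sum_filter, Finset.sum_const, nsmul_eq_mul]
    exact mul_le_mul_of_nonneg_right (hM q hq) (by positivity)
  calc 2 * ∑ q ∈ s, ∑ q' ∈ s, (if ∀ k, |y q k - y q' k| ≤ δ k then ‖b q‖ ^ 2 / 2 else 0)
      ≤ 2 * ∑ q ∈ s, M * (‖b q‖ ^ 2 / 2) := by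
        refine mul_le_mul_of_nonneg_left (Finset.sum_le_sum h4) (by norm_num)
    _ = M * ∑ q ∈ s, ‖b q‖ ^ 2 := by
        rw [Finset.mul_sum, Finset.mul_sum]
        refine Finset.sum_congr rfl fun q _ => ?_
        ring

/-- **The discrete large sieve from the double large sieve.** For finite families of points
`x_p, y_q ∈ ℝ^ι` with `|x_{p,k}| ≤ X_k`, `|y_{q,k}| ≤ Y_k`, such that each `x_p` has at most `A` members
of the `x`-family within `1/(2Y_k)` (all `k`) and each `y_q` at most `B` members of the `y`-family
within `1/(2X_k)`, and any coefficients `a_p`: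
`∑_q |∑_p a_p e(x_p · y_q)|² ≤ 624^{#ι} ∏_k (1 + X_k Y_k) · A · B · ∑_p |a_p|²`.
(Duality applied to `DoubleLargeSieve.doubleLargeSieve` with `b_q = conj(∑_p a_p e(x_p·y_q))`.)
[cite: GrahamKolesnik1991, Lemma 7.5] -/
theorem discreteLargeSieve_of_neighbours (sX : Finset α) (sY : Finset β)
    (x : α → ι → ℝ) (y : β → ι → ℝ) (a : α → ℂ) (X Y : ι → ℝ) (hX : ∀ k, 0 < X k) (hY : ∀ k, 0 < Y k)
    (hx : ∀ p ∈ sX, ∀ k, |x p k| ≤ X k) (hy : ∀ q ∈ sY, ∀ k, |y q k| ≤ Y k) {A B : ℕ}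
    (hA : ∀ p ∈ sX, (sX.filter fun p' => ∀ k, |x p k - x p' k| ≤ (2 * Y k)⁻¹).card ≤ A)
    (hB : ∀ q ∈ sY, (sY.filter fun q' => ∀ k, |y q k - y q' k| ≤ (2 * X k)⁻¹).card ≤ B) :
    ∑ q ∈ sY, ‖∑ p ∈ sX, a p * e (∑ k, x p k * y q k)‖ ^ 2 ≤
      624 ^ Fintype.card ι * (∏ k, (1 + X k * Y k)) * A * B * ∑ p ∈ sX, ‖a p‖ ^ 2 := by
  classical
  set T : β → ℂ := fun q => ∑ p ∈ sX, a p * e (∑ k, x p k * y q k) with hT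
  set b : β → ℂ := fun q => conj (T q) with hb
  -- the left-hand side as a bilinear form
  have hLHS : ((∑ q ∈ sY, ‖T q‖ ^ 2 : ℝ) : ℂ) =
      ∑ p ∈ sX, ∑ q ∈ sY, a p * b q * e (∑ k, x p k * y q k) := by
    rw [Finset.sum_comm]
    push_cast
    refine Finset.sum_congr rfl fun q _ => ?_
    have : ∑ p ∈ sX, a p * b q * e (∑ k, x p k * y q k) = b q * T q := by
      rw [hT, Finset.mul_sum]
      refine Finset.sum_congr rfl fun p _ => ?_
      ring
    rw [this, hb, mul_comm, Complex.mul_conj, Complex.normSq_eq_norm_sq]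
    push_cast
    ring
  have hDLS := doubleLargeSieve sX sY x y a b X Y hX hY hx hy
  -- neighbour counts
  have hA' : ∀ p ∈ sX, ((sX.filter fun p' => ∀ k, |x p k - x p' k| ≤ (2 * Y k)⁻¹).card : ℝ) ≤ A :=
    fun p hp => by exact_mod_cast hA p hp
  have hB' : ∀ q ∈ sY, ((sY.filter fun q' => ∀ k, |y q k - y q' k| ≤ (2 * X k)⁻¹).card : ℝ) ≤ B :=
    fun q hq => by exact_mod_cast hB q hq
  have hNa : neighbourCount sX x a (fun k => (2 * Y k)⁻¹) ≤ A * ∑ p ∈ sX, ‖a p‖ ^ 2 :=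
    neighbourCount_le_of_card_le sX x a _ hA'
  have hNb : neighbourCount sY y b (fun k => (2 * X k)⁻¹) ≤ B * ∑ q ∈ sY, ‖b q‖ ^ 2 :=
    neighbourCount_le_of_card_le sY y b _ hB'
  have hbT : ∑ q ∈ sY, ‖b q‖ ^ 2 = ∑ q ∈ sY, ‖T q‖ ^ 2 := by
    refine Finset.sum_congr rfl fun q _ => ?_
    rw [hb]
    simp
  set L : ℝ := ∑ q ∈ sY, ‖T q‖ ^ 2 with hL
  have hL0 : 0 ≤ L := Finset.sum_nonneg fun q _ => by positivity
  set D : ℝ := 624 ^ Fintype.card ι * (∏ k, (1 + X k * Y k)) with hD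
  have hD0 : 0 ≤ D := by
    rw [hD]
    refine mul_nonneg (by positivity) (Finset.prod_nonneg fun k _ => ?_)
    have := hX k
    have := hY k
    positivity
  have hS0 : 0 ≤ ∑ p ∈ sX, ‖a p‖ ^ 2 := Finset.sum_nonneg fun p _ => by positivity
  -- `L² ≤ D · (A Σ|a|²) · (B L)`
  have hsq : L ^ 2 ≤ D * (A * ∑ p ∈ sX, ‖a p‖ ^ 2) * (B * L) := by
    have h1 : ‖∑ p ∈ sX, ∑ q ∈ sY, a p * b q * e (∑ k, x p k * y q k)‖ ^ 2 = L ^ 2 := by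
      rw [← hLHS, Complex.norm_real, Real.norm_of_nonneg hL0]
    rw [← h1]
    refine hDLS.trans ?_
    rw [hbT] at hNb
    have hNa0 := neighbourCount_nonneg sX x a (fun k => (2 * Y k)⁻¹)
    calc 624 ^ Fintype.card ι * (∏ k, (1 + X k * Y k)) * neighbourCount sX x a (fun k => (2 * Y k)⁻¹) *
          neighbourCount sY y b (fun k => (2 * X k)⁻¹)
        = D * neighbourCount sX x a (fun k => (2 * Y k)⁻¹) *
            neighbourCount sY y b (fun k => (2 * X k)⁻¹) := by rw [hD]
      _ ≤ D * (A * ∑ p ∈ sX, ‖a p‖ ^ 2) * (B * L) :=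
          mul_le_mul (mul_le_mul_of_nonneg_left hNa hD0) hNb (neighbourCount_nonneg _ _ _ _)
            (mul_nonneg hD0 (le_trans hNa0 hNa))
  -- conclude by cancelling one factor `L`
  have hgoal : L ≤ D * A * B * ∑ p ∈ sX, ‖a p‖ ^ 2 := by
    rcases hL0.eq_or_lt with h | h
    · rw [← h]
      have := mul_nonneg (mul_nonneg (mul_nonneg hD0 (Nat.cast_nonneg A)) (Nat.cast_nonneg B)) hS0
      linarith
    · have h2 : L * L ≤ (D * A * B * ∑ p ∈ sX, ‖a p‖ ^ 2) * L := by nlinarith [hsq]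
      exact le_of_mul_le_mul_right h2 h
  calc ∑ q ∈ sY, ‖T q‖ ^ 2 = L := rfl
    _ ≤ D * A * B * ∑ p ∈ sX, ‖a p‖ ^ 2 := hgoal
    _ = 624 ^ Fintype.card ι * (∏ k, (1 + X k * Y k)) * A * B * ∑ p ∈ sX, ‖a p‖ ^ 2 := by rw [hD]

end Discrete

/-! ## Real Minkowski coordinates of a totally real field -/

section Field

open Module
open scoped Classical

variable (K : Type*) [Field K] [NumberField K]

/-- The real Minkowski coordinates of `x ∈ K` at the real places: `remb x w = σ_w(x)`.
(For `α ∈ 𝓞_K` this is `CastilloEtAl2015.realEmb K α`, `realEmb_eq_remb`.) [folklore] -/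
def remb (x : K) (w : {w : InfinitePlace K // w.IsReal}) : ℝ := embedding_of_isReal w.2 x

omit [NumberField K] in
/-- `remb` is additive. [folklore] -/
@[simp] theorem remb_add (x y : K) : remb K (x + y) = remb K x + remb K y := by
  ext w; simp [remb]

omit [NumberField K] in
/-- `remb` respects subtraction. [folklore] -/
@[simp] theorem remb_sub (x y : K) : remb K (x - y) = remb K x - remb K y := by
  ext w; simp [remb]

omit [NumberField K] in
/-- `remb` is multiplicative (coordinatewise). [folklore] -/
@[simp] theorem remb_mul (x y : K) : remb K (x * y) = remb K x * remb K y := by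
  ext w; simp [remb]

omit [NumberField K] in
/-- `remb 0 = 0`. [folklore] -/
@[simp] theorem remb_zero : remb K 0 = 0 := by ext w; simp [remb]

omit [NumberField K] in
/-- `|remb x w| = w(x)` (the place is the absolute value of its real embedding). [folklore] -/
theorem abs_remb (x : K) (w : {w : InfinitePlace K // w.IsReal}) : |remb K x w| = w.1 x := by
  rw [remb, ← Real.norm_eq_abs, norm_embedding_of_isReal]

omit [NumberField K] in
/-- `remb x = 0 ↔ x = 0` at any coordinate. [folklore] -/
theorem remb_apply_ne_zero {x : K} (hx : x ≠ 0) (w : {w : InfinitePlace K // w.IsReal}) :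
    remb K x w ≠ 0 := by
  rw [remb]; exact (map_ne_zero _).2 hx

omit [NumberField K] in
/-- `remb` extends the tree's `realEmb` on `𝓞_K`. [folklore] -/
theorem realEmb_eq_remb [IsTotallyReal K] (α : 𝓞 K) :
    CastilloEtAl2015.realEmb K α = remb K (α : K) := rfl

variable [IsTotallyReal K]

/-- All infinite places of a totally real field are real: the subtype is everything. [folklore] -/
def realPlacesEquiv : {w : InfinitePlace K // w.IsReal} ≃ InfinitePlace K :=
  Equiv.subtypeUnivEquiv fun w => IsTotallyReal.isReal w

/-- `#{w real} = [K : ℚ]` for totally real `K`. [folklore] -/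
theorem card_realPlaces : Fintype.card {w : InfinitePlace K // w.IsReal} = finrank ℚ K :=
  (IsTotallyReal.finrank K).symm

/-- **The trace through the real places**: `Tr_{K/ℚ}(x) = ∑_w σ_w(x)` for totally real `K`
(Mathlib `trace_eq_sum_embeddings`; cf. `LFunctions.NumberField.trace_eq_sum_mult_mul_re`). [folklore] -/
theorem trace_eq_sum_remb (x : K) :
    ((Algebra.trace ℚ K x : ℚ) : ℝ) = ∑ w : {w : InfinitePlace K // w.IsReal}, remb K x w := by
  classical
  have h := trace_eq_sum_embeddings ℂ (K := ℚ) (L := K) (x := x)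
  have h2 : ((Algebra.trace ℚ K x : ℚ) : ℂ) = ∑ φ : K →+* ℂ, φ x := by
    rw [eq_ratCast] at h
    rw [h, ← Fintype.sum_equiv RingHom.equivRatAlgHom (fun φ : K →+* ℂ ↦ φ x)
      (fun σ : K →ₐ[ℚ] ℂ ↦ σ x) (fun φ ↦ by simp [RingHom.equivRatAlgHom_apply])]
  have h3 : ((Algebra.trace ℚ K x : ℚ) : ℝ) = (∑ φ : K →+* ℂ, φ x).re := by
    rw [← h2]; norm_cast
  have h4 : (∑ φ : K →+* ℂ, φ x).re = ∑ w : InfinitePlace K, (w.embedding x).re := by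
    rw [Complex.re_sum, ← Finset.sum_fiberwise Finset.univ InfinitePlace.mk (fun φ : K →+* ℂ ↦ (φ x).re)]
    refine Finset.sum_congr rfl fun w _ ↦ ?_
    have hφ : ∀ φ ∈ ({φ ∈ Finset.univ | InfinitePlace.mk φ = w} : Finset (K →+* ℂ)),
        (φ x).re = (w.embedding x).re := by
      intro φ hφ
      have hw : InfinitePlace.mk φ = InfinitePlace.mk w.embedding := by
        rw [(Finset.mem_filter.mp hφ).2, mk_embedding]
      rcases mk_eq_iff.mp hw with h | h
      · rw [h]
      · rw [← h, ComplexEmbedding.conjugate_coe_eq, Complex.conj_re]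
    rw [Finset.sum_congr rfl hφ, Finset.sum_const, card_filter_mk_eq, nsmul_eq_mul,
      IsTotallyReal.mult_eq, Nat.cast_one, one_mul]
  rw [h3, h4, ← Fintype.sum_equiv (realPlacesEquiv K) (fun w => remb K x w)
    (fun w => (w.embedding x).re) ?_]
  intro w
  show remb K x w = ((realPlacesEquiv K w).embedding x).re
  have hw : (realPlacesEquiv K w) = w.1 := rfl
  rw [hw, remb, ← embedding_of_isReal_apply w.2 x, Complex.ofReal_re]

/-- `e(Tr(x)) = e(∑_w σ_w x)`: the additive character of the trace in real coordinates. [folklore] -/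
theorem e_trace (x : K) :
    e ((Algebra.trace ℚ K x : ℚ) : ℝ) = e (∑ w : {w : InfinitePlace K // w.IsReal}, remb K x w) := by
  rw [trace_eq_sum_remb]

/-- **`|N(x)| = ∏_w |σ_w x|`** for totally real `K` (Mathlib `prod_eq_abs_norm`). [folklore] -/
theorem abs_norm_eq_prod_abs_remb (x : K) :
    |((Algebra.norm ℚ x : ℚ) : ℝ)| = ∏ w : {w : InfinitePlace K // w.IsReal}, |remb K x w| := by
  have h := prod_eq_abs_norm x
  simp only [IsTotallyReal.mult_eq, pow_one] at h
  rw [Rat.cast_abs] at h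
  rw [← h, ← Fintype.prod_equiv (realPlacesEquiv K) (fun w => |remb K x w|) (fun w => w x)
    (fun w => by rw [abs_remb]; rfl)]

/-- **An element of large norm has a large coordinate**: if `η ≤ |N(x)|` (`η ≥ 0`) then some
`|σ_w x| ≥ η^{1/d}`, `d = [K:ℚ]`. [folklore] -/
theorem exists_rpow_le_abs_remb {x : K} {η : ℝ} (hη : 0 ≤ η)
    (h : η ≤ |((Algebra.norm ℚ x : ℚ) : ℝ)|) :
    ∃ w : {w : InfinitePlace K // w.IsReal}, η ^ (1 / (finrank ℚ K : ℝ)) ≤ |remb K x w| := by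
  have hd : 0 < finrank ℚ K := finrank_pos
  haveI : Nonempty {w : InfinitePlace K // w.IsReal} := by
    rw [← Fintype.card_pos_iff, card_realPlaces]; exact hd
  rcases eq_or_ne x 0 with rfl | hx
  · -- then `η = 0`
    have h0 : η = 0 := by
      refine le_antisymm ?_ hη
      simpa using h
    refine ⟨Classical.arbitrary _, ?_⟩
    rw [h0, Real.zero_rpow (one_div_ne_zero (by exact_mod_cast hd.ne')), remb_zero, Pi.zero_apply,
      abs_zero]
  by_contra hcon
  push Not at hcon
  have hprod : ∏ w : {w : InfinitePlace K // w.IsReal}, |remb K x w| <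
      ∏ _w : {w : InfinitePlace K // w.IsReal}, η ^ (1 / (finrank ℚ K : ℝ)) :=
    Finset.prod_lt_prod_of_nonempty (fun w _ => abs_pos.2 (remb_apply_ne_zero K hx w))
      (fun w _ => hcon w) Finset.univ_nonempty
  rw [Finset.prod_const, Finset.card_univ, card_realPlaces, ← Real.rpow_natCast,
    ← Real.rpow_mul hη, one_div_mul_cancel (by exact_mod_cast hd.ne'), Real.rpow_one,
    ← abs_norm_eq_prod_abs_remb] at hprod
  exact absurd h (not_le.2 hprod)

end Field

/-! ## Separated families in `ℝ^ι`: counting neighbours by integer parts -/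

section Separated

variable {ι : Type*} [Fintype ι] [DecidableEq ι] {ρ' : Type*}

/-- **A `δ`-separated family has few members in a box**: if distinct members of the family differ
by at least `δ > 0` in some coordinate, then the box of half-sides `ρ_k ≥ 0` around any member
contains at most `∏_k (2⌊ρ_k/δ⌋ + 2)` members (the integer parts `⌊(y_{r',k} − y_{r,k})/δ⌋`
determine `r'`). [folklore] -/
theorem card_filter_close_le_of_separated (R : Finset ρ') (y : ρ' → ι → ℝ) {δ : ℝ} (hδ : 0 < δ)
    (hsep : ∀ r ∈ R, ∀ r' ∈ R, r ≠ r' → ∃ k, δ ≤ |y r k - y r' k|) (ρ : ι → ℝ) (hρ : ∀ k, 0 ≤ ρ k)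
    (r₀ : ρ') :
    (R.filter fun r' => ∀ k, |y r₀ k - y r' k| ≤ ρ k).card ≤ ∏ k, (2 * ⌊ρ k / δ⌋₊ + 2) := by
  classical
  set F : ρ' → ι → ℤ := fun r' k => ⌊(y r' k - y r₀ k) / δ⌋ with hF
  set T : Finset (ι → ℤ) := Fintype.piFinset fun k => Finset.Icc (-((⌊ρ k / δ⌋₊ : ℤ) + 1)) (⌊ρ k / δ⌋₊ : ℤ)
    with hT
  have hmaps : ∀ r' ∈ R.filter (fun r' => ∀ k, |y r₀ k - y r' k| ≤ ρ k), F r' ∈ T := by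
    intro r' hr'
    rw [Finset.mem_filter] at hr'
    rw [hT, Fintype.mem_piFinset]
    intro k
    have hk := hr'.2 k
    rw [abs_sub_comm, abs_le] at hk
    have hq : -(ρ k / δ) ≤ (y r' k - y r₀ k) / δ ∧ (y r' k - y r₀ k) / δ ≤ ρ k / δ := by
      constructor
      · have := div_le_div_of_nonneg_right hk.1 hδ.le
        rwa [neg_div] at this
      · exact div_le_div_of_nonneg_right hk.2 hδ.le
    have hfl : (⌊ρ k / δ⌋₊ : ℤ) = ⌊ρ k / δ⌋ := Int.natCast_floor_eq_floor (div_nonneg (hρ k) hδ.le)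
    rw [Finset.mem_Icc, hfl]
    constructor
    · have h1 : ⌊-(ρ k / δ)⌋ ≤ ⌊(y r' k - y r₀ k) / δ⌋ := Int.floor_mono hq.1
      have h2 : -⌊ρ k / δ⌋ - 1 ≤ ⌊-(ρ k / δ)⌋ := by
        rw [Int.floor_neg]
        have := Int.ceil_le_floor_add_one (ρ k / δ)
        omega
      show -(⌊ρ k / δ⌋ + 1) ≤ F r' k
      simp only [hF]; omega
    · show F r' k ≤ ⌊ρ k / δ⌋
      exact Int.floor_mono hq.2
  have hinj : Set.InjOn F (R.filter (fun r' => ∀ k, |y r₀ k - y r' k| ≤ ρ k) : Set ρ') := by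
    intro r₁ hr₁ r₂ hr₂ hEq
    rw [Finset.coe_filter, Set.mem_setOf_eq] at hr₁ hr₂
    by_contra hne
    obtain ⟨k, hk⟩ := hsep r₁ hr₁.1 r₂ hr₂.1 hne
    have hEqk : F r₁ k = F r₂ k := congrFun hEq k
    simp only [hF] at hEqk
    -- equal integer parts force the difference to be `< δ`
    have h1 := Int.floor_le ((y r₁ k - y r₀ k) / δ)
    have h2 := Int.lt_floor_add_one ((y r₁ k - y r₀ k) / δ)
    have h3 := Int.floor_le ((y r₂ k - y r₀ k) / δ)
    have h4 := Int.lt_floor_add_one ((y r₂ k - y r₀ k) / δ)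
    rw [hEqk] at h1 h2
    have hlt : |(y r₁ k - y r₀ k) / δ - (y r₂ k - y r₀ k) / δ| < 1 := by
      rw [abs_lt]; constructor <;> linarith
    rw [← sub_div, abs_div, abs_of_pos hδ, div_lt_one hδ] at hlt
    have : y r₁ k - y r₀ k - (y r₂ k - y r₀ k) = y r₁ k - y r₂ k := by ring
    rw [this] at hlt
    linarith
  calc (R.filter fun r' => ∀ k, |y r₀ k - y r' k| ≤ ρ k).card ≤ T.card :=
        Finset.card_le_card_of_injOn F hmaps hinj
    _ = ∏ k, (2 * ⌊ρ k / δ⌋₊ + 2) := by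
        rw [hT, Fintype.card_piFinset]
        refine Finset.prod_congr rfl fun k _ => ?_
        rw [Int.card_Icc]
        have : (⌊ρ k / δ⌋₊ : ℤ) + 1 - -((⌊ρ k / δ⌋₊ : ℤ) + 1) = ((2 * ⌊ρ k / δ⌋₊ + 2 : ℕ) : ℤ) := by
          push_cast; ring
        rw [this, Int.toNat_natCast]

omit [DecidableEq ι] in
/-- The real form of the neighbour bound: `∏_k (2⌊ρ_k/δ⌋ + 2) ≤ ∏_k (2ρ_k/δ + 2)`. [folklore] -/
theorem cast_prod_floor_le (ρ : ι → ℝ) {δ : ℝ} (hδ : 0 < δ) (hρ : ∀ k, 0 ≤ ρ k) :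
    ((∏ k, (2 * ⌊ρ k / δ⌋₊ + 2) : ℕ) : ℝ) ≤ ∏ k, (2 * (ρ k / δ) + 2) := by
  push_cast
  refine Finset.prod_le_prod (fun k _ => by positivity) fun k _ => ?_
  have := Nat.floor_le (div_nonneg (hρ k) hδ.le)
  linarith

end Separated

/-! ## Ideal lattices of a totally real field in the sup-norm -/

section Lattice

open Module IsDedekindDomain
open scoped Classical nonZeroDivisors

variable (K : Type*) [Field K] [NumberField K] [IsTotallyReal K]

/-- **Points of an ideal are `N𝔞^{1/d}`-separated**: for `α ≠ α'` in `𝔞`, some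
`|σ_w(α − α')| ≥ N𝔞^{1/d}` (`|N(α − α')| ≥ N𝔞`). [folklore] -/
theorem exists_rpow_absNorm_le_abs_remb_sub {𝔞 : Ideal (𝓞 K)} {α α' : 𝓞 K} (hα : α ∈ 𝔞)
    (hα' : α' ∈ 𝔞) (hne : α ≠ α') :
    ∃ w : {w : InfinitePlace K // w.IsReal},
      (Ideal.absNorm 𝔞 : ℝ) ^ (1 / (finrank ℚ K : ℝ)) ≤ |remb K (α : K) w - remb K (α' : K) w| := by
  have hsub : α - α' ∈ 𝔞 := 𝔞.sub_mem hα hα'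
  have hne0 : α - α' ≠ 0 := sub_ne_zero.2 hne
  have h := CastilloEtAl2015.absNorm_le_abs_norm_of_mem K hsub hne0
  obtain ⟨w, hw⟩ := exists_rpow_le_abs_remb K (Nat.cast_nonneg _) h
  refine ⟨w, ?_⟩
  rw [← Pi.sub_apply, ← remb_sub]
  push_cast at hw ⊢
  exact hw

/-- **Few points of an ideal in a box of side `≍ N𝔞^{1/d}`**: for `α₀ ∈ 𝓞_K`, `c ≥ 0` and a finite
`S ⊆ 𝔞`, at most `(2⌊c⌋ + 2)^d` elements `α' ∈ S` have all `|σ_w(α₀ − α')| ≤ c N𝔞^{1/d}`.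
[folklore] -/
theorem card_filter_ideal_close_le {𝔞 : Ideal (𝓞 K)} (h𝔞 : 𝔞 ≠ ⊥) (S : Finset (𝓞 K))
    (hS : ∀ α ∈ S, α ∈ 𝔞) {c : ℝ} (hc : 0 ≤ c) (α₀ : 𝓞 K) :
    (S.filter fun α' : 𝓞 K => ∀ w, |remb K (α₀ : K) w - remb K (α' : K) w| ≤
        c * (Ideal.absNorm 𝔞 : ℝ) ^ (1 / (finrank ℚ K : ℝ))).card ≤
      (2 * ⌊c⌋₊ + 2) ^ finrank ℚ K := by
  set δ : ℝ := (Ideal.absNorm 𝔞 : ℝ) ^ (1 / (finrank ℚ K : ℝ)) with hδ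
  have hN0 : 0 < (Ideal.absNorm 𝔞 : ℝ) := by
    have : Ideal.absNorm 𝔞 ≠ 0 := by rwa [Ne, Ideal.absNorm_eq_zero_iff]
    positivity
  have hδ0 : 0 < δ := Real.rpow_pos_of_pos hN0 _
  have hsep : ∀ r ∈ S, ∀ r' ∈ S, r ≠ r' → ∃ k, δ ≤ |remb K (r : K) k - remb K (r' : K) k| :=
    fun r hr r' hr' hne => exists_rpow_absNorm_le_abs_remb_sub K (hS r hr) (hS r' hr') hne
  have h := card_filter_close_le_of_separated S (fun α : 𝓞 K => remb K (α : K)) hδ0 hsep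
    (fun _ => c * δ) (fun _ => by positivity) α₀
  have hcδ : c * δ / δ = c := mul_div_cancel_right₀ c hδ0.ne'
  simp only [hcδ, Finset.prod_const, Finset.card_univ] at h
  rwa [card_realPlaces] at h

omit [IsTotallyReal K] in
/-- `N((m)) = m^d` for a natural number `m`. [folklore] -/
private theorem absNorm_span_natCast (m : ℕ) :
    Ideal.absNorm (Ideal.span {((m : ℕ) : 𝓞 K)}) = m ^ finrank ℚ K := by
  rw [Ideal.absNorm_span_singleton, show ((m : ℕ) : 𝓞 K) = algebraMap ℤ (𝓞 K) (m : ℤ) by simp,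
    Algebra.norm_algebraMap, RingOfIntegers.rank]
  simp [Int.natAbs_pow]

omit [IsTotallyReal K] in
/-- **A balanced short vector in `𝔞⁻¹`**: there is `C = C(K) > 0` such that every nonzero ideal `𝔞`
has `b ∈ 𝔞⁻¹`, `b ≠ 0`, with `|σ_w b| ≤ C N𝔞^{-1/d}` at every place (Minkowski's short vector of the
integral ideal `N𝔞 · 𝔞⁻¹`, of norm `N𝔞^{d−1}`, divided by `N𝔞`). [folklore] -/
theorem exists_short_mem_inv : ∃ C : ℝ, 0 < C ∧ ∀ 𝔞 : Ideal (𝓞 K), 𝔞 ≠ ⊥ →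
    ∃ b : K, b ∈ ((𝔞 : FractionalIdeal (𝓞 K)⁰ K))⁻¹ ∧ b ≠ 0 ∧
      ∀ w, |remb K b w| ≤ C * (Ideal.absNorm 𝔞 : ℝ) ^ (-(1 / (finrank ℚ K : ℝ))) := by
  obtain ⟨c₁, hc₁, hshort⟩ := CastilloEtAl2015.exists_ne_zero_mem_ideal_forall_lt K
  refine ⟨c₁, hc₁, fun 𝔞 h𝔞 => ?_⟩
  set d : ℕ := finrank ℚ K with hd
  have hd0 : 0 < d := finrank_pos
  set m : ℕ := Ideal.absNorm 𝔞 with hm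
  have hm0 : 0 < m := Nat.pos_of_ne_zero (by rw [hm, Ne, Ideal.absNorm_eq_zero_iff]; exact h𝔞)
  have hmR : (0 : ℝ) < m := by exact_mod_cast hm0
  have hmmem : ((m : ℕ) : 𝓞 K) ∈ 𝔞 := Ideal.absNorm_mem 𝔞
  have hdvd : 𝔞 ∣ Ideal.span {((m : ℕ) : 𝓞 K)} :=
    Ideal.dvd_iff_le.2 ((Ideal.span_singleton_le_iff_mem _).2 hmmem)
  obtain ⟨J, hJ⟩ := hdvd
  have hm0' : ((m : ℕ) : 𝓞 K) ≠ 0 := by exact_mod_cast hm0.ne'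
  have hJ0 : J ≠ ⊥ := by
    rintro rfl
    rw [Ideal.mul_bot, Ideal.span_singleton_eq_bot] at hJ
    exact hm0' hJ
  -- norms
  have hNJ : (Ideal.absNorm J : ℝ) = (m : ℝ) ^ (d - 1) := by
    have h1 : Ideal.absNorm (Ideal.span {((m : ℕ) : 𝓞 K)}) = m * Ideal.absNorm J := by
      rw [hJ, map_mul]
    rw [absNorm_span_natCast] at h1
    have h2 : (m : ℝ) ^ d = m * Ideal.absNorm J := by exact_mod_cast h1
    have h3 : (m : ℝ) ^ d = m * (m : ℝ) ^ (d - 1) := by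
      rw [← pow_succ', Nat.sub_add_cancel hd0]
    rw [h3] at h2
    exact (mul_left_cancel₀ hmR.ne' h2).symm
  obtain ⟨x, hxJ, hx0, hxlt⟩ := hshort ⟨J, mem_nonZeroDivisors_of_ne_zero hJ0⟩
  simp only at hxJ hxlt
  refine ⟨(x : K) / m, ?_, ?_, ?_⟩
  · rw [FractionalIdeal.mem_inv_iff (FractionalIdeal.coeIdeal_ne_zero.2 h𝔞)]
    intro y hy
    obtain ⟨a, ha, rfl⟩ := (FractionalIdeal.mem_coeIdeal _).1 hy
    have hxa : x * a ∈ Ideal.span {((m : ℕ) : 𝓞 K)} := by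
      rw [hJ, mul_comm 𝔞 J]; exact Ideal.mul_mem_mul hxJ ha
    obtain ⟨z, hz⟩ := Ideal.mem_span_singleton'.1 hxa
    rw [FractionalIdeal.mem_one_iff]
    refine ⟨z, ?_⟩
    have hz' : ((z : K) * m) = x * a := by exact_mod_cast congrArg (fun t : 𝓞 K => (t : K)) hz
    show (algebraMap (𝓞 K) K) z = (x : K) / m * (algebraMap (𝓞 K) K) a
    change (z : K) = (x : K) / m * (a : K)
    have hmK : ((m : ℕ) : K) ≠ 0 := by exact_mod_cast hm0.ne'
    rw [div_mul_eq_mul_div, eq_div_iff hmK]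
    exact hz'
  · exact div_ne_zero (by exact_mod_cast hx0) (by exact_mod_cast hm0.ne')
  · intro w
    have hw := hxlt w.1
    rw [← abs_remb] at hw
    have hrw : remb K ((x : K) / m) w = remb K (x : K) w / m := by
      simp [remb, map_div₀]
    rw [hrw, abs_div, Nat.abs_cast, div_le_iff₀ hmR]
    refine hw.le.trans (le_of_eq ?_)
    rw [hNJ, ← Real.rpow_natCast, ← Real.rpow_mul hmR.le, mul_assoc, ← Real.rpow_add_one hmR.ne']
    congr 1
    congr 1
    rw [Nat.cast_sub hd0]
    field_simp
    ring

/-- `realLatticeBasis` is `remb` of the integral basis. [folklore] -/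
theorem realLatticeBasis_apply (i : Free.ChooseBasisIndex ℤ (𝓞 K)) :
    CastilloEtAl2015.realLatticeBasis K i = remb K (RingOfIntegers.basis K i : K) := by
  rw [CastilloEtAl2015.realLatticeBasis, Basis.map_apply, CastilloEtAl2015.fstEquiv_apply,
    mixedEmbedding.latticeBasis_apply, integralBasis_apply]
  rfl

omit [NumberField K] [IsTotallyReal K] in
/-- `remb` of a finite sum. [folklore] -/
theorem remb_sum {ι' : Type*} (s : Finset ι') (f : ι' → K) :
    remb K (∑ i ∈ s, f i) = ∑ i ∈ s, remb K (f i) := by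
  ext w; simp [remb, map_sum]

/-- **Integral approximation**: every `v ∈ ℝ^ι` is within `C₂ = C₂(K)` of `remb(𝓞_K)` in every
coordinate (round the coordinates in the real lattice basis). [folklore] -/
theorem exists_int_remb_sub_le : ∃ C₂ : ℝ, 0 ≤ C₂ ∧ ∀ v : {w : InfinitePlace K // w.IsReal} → ℝ,
    ∃ z : 𝓞 K, ∀ w, |v w - remb K (z : K) w| ≤ C₂ := by
  set B := CastilloEtAl2015.realLatticeBasis K with hB
  refine ⟨∑ i, ‖B i‖, Finset.sum_nonneg fun i _ => norm_nonneg _, fun v => ?_⟩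
  set t : Free.ChooseBasisIndex ℤ (𝓞 K) → ℝ := fun i => B.repr v i with ht
  refine ⟨∑ i, ⌊t i⌋ • RingOfIntegers.basis K i, fun w => ?_⟩
  have hv : v = ∑ i, t i • B i := (B.sum_repr v).symm
  have hz : remb K ((∑ i, ⌊t i⌋ • RingOfIntegers.basis K i : 𝓞 K) : K) = ∑ i, (⌊t i⌋ : ℝ) • B i := by
    push_cast
    rw [remb_sum]
    refine Finset.sum_congr rfl fun i _ => ?_
    rw [hB, realLatticeBasis_apply, zsmul_eq_mul]
    rw [remb_mul]
    ext w
    simp [remb]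
  rw [hz, hv, Finset.sum_apply, Finset.sum_apply, ← Finset.sum_sub_distrib]
  refine (Finset.abs_sum_le_sum_abs _ _).trans (Finset.sum_le_sum fun i _ => ?_)
  rw [Pi.smul_apply, Pi.smul_apply, smul_eq_mul, smul_eq_mul, ← sub_mul, abs_mul]
  have h1 : |t i - ⌊t i⌋| ≤ 1 := by
    rw [abs_le]
    constructor <;> linarith [Int.floor_le (t i), Int.lt_floor_add_one (t i)]
  calc |t i - ⌊t i⌋| * |B i w| ≤ 1 * ‖B i‖ :=
        mul_le_mul h1 (by rw [← Real.norm_eq_abs]; exact norm_le_pi_norm _ _) (abs_nonneg _) zero_le_one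
    _ = ‖B i‖ := one_mul _

/-- **Small representatives modulo `𝔞⁻¹`**: there is `C = C(K) > 0` such that for every nonzero
ideal `𝔞` and every `v ∈ ℝ^ι` some `λ ∈ 𝔞⁻¹` has `|v_w − σ_w λ| ≤ C N𝔞^{-1/d}` for all `w`
(a fundamental domain of the ideal lattice `𝔞⁻¹` of covolume `≍ N𝔞⁻¹` fits in a cube of side
`≍ N𝔞^{-1/d}`). [folklore] -/
theorem exists_mem_inv_remb_sub_le : ∃ C : ℝ, 0 < C ∧ ∀ 𝔞 : Ideal (𝓞 K), 𝔞 ≠ ⊥ →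
    ∀ v : {w : InfinitePlace K // w.IsReal} → ℝ, ∃ l : K, l ∈ ((𝔞 : FractionalIdeal (𝓞 K)⁰ K))⁻¹ ∧
      ∀ w, |v w - remb K l w| ≤ C * (Ideal.absNorm 𝔞 : ℝ) ^ (-(1 / (finrank ℚ K : ℝ))) := by
  obtain ⟨C₁, hC₁, hshort⟩ := exists_short_mem_inv K
  obtain ⟨C₂, hC₂, happrox⟩ := exists_int_remb_sub_le K
  refine ⟨C₁ * (C₂ + 1), by positivity, fun 𝔞 h𝔞 v => ?_⟩
  obtain ⟨b, hb, hb0, hble⟩ := hshort 𝔞 h𝔞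
  obtain ⟨z, hz⟩ := happrox (fun w => v w / remb K b w)
  refine ⟨(z : K) * b, ?_, fun w => ?_⟩
  · have : (z : K) * b = z • b := by rw [Algebra.smul_def]
    rw [this]
    exact Submodule.smul_mem _ z hb
  · have hbw : remb K b w ≠ 0 := remb_apply_ne_zero K hb0 w
    have hzw := hz w
    have hEq : v w - remb K ((z : K) * b) w = remb K b w * (v w / remb K b w - remb K (z : K) w) := by
      rw [remb_mul, Pi.mul_apply]; field_simp
    rw [hEq, abs_mul]
    have hN : 0 ≤ (Ideal.absNorm 𝔞 : ℝ) ^ (-(1 / (finrank ℚ K : ℝ))) := Real.rpow_nonneg (Nat.cast_nonneg _) _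
    calc |remb K b w| * |v w / remb K b w - remb K (z : K) w|
        ≤ (C₁ * (Ideal.absNorm 𝔞 : ℝ) ^ (-(1 / (finrank ℚ K : ℝ)))) * (C₂ + 1) :=
          mul_le_mul (hble w) (hzw.trans (by linarith)) (abs_nonneg _) (by positivity)
      _ = C₁ * (C₂ + 1) * (Ideal.absNorm 𝔞 : ℝ) ^ (-(1 / (finrank ℚ K : ℝ))) := by ring

omit [IsTotallyReal K] in
/-- **Translating by `𝔞⁻¹` does not change the character on `𝔞`**: for `α ∈ 𝔞` and `λ ∈ 𝔞⁻¹`,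
`e(Tr(α(κ + λ))) = e(Tr(ακ))` (`αλ ∈ 𝓞_K` has integral trace). [folklore] -/
theorem e_trace_mul_add_of_mem_inv {𝔞 : Ideal (𝓞 K)} (h𝔞 : 𝔞 ≠ ⊥) {α : 𝓞 K} (hα : α ∈ 𝔞) {l : K}
    (hl : l ∈ ((𝔞 : FractionalIdeal (𝓞 K)⁰ K))⁻¹) (κ : K) :
    e ((Algebra.trace ℚ K ((α : K) * (κ + l)) : ℚ) : ℝ) = e ((Algebra.trace ℚ K ((α : K) * κ) : ℚ) : ℝ) := by
  have h1 : l * (α : K) ∈ (1 : FractionalIdeal (𝓞 K)⁰ K) :=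
    (FractionalIdeal.mem_inv_iff (FractionalIdeal.coeIdeal_ne_zero.2 h𝔞)).1 hl _
      (FractionalIdeal.mem_coeIdeal_of_mem _ hα)
  obtain ⟨z, hz⟩ := (FractionalIdeal.mem_one_iff _).1 h1
  have hint : IsIntegral ℤ (Algebra.trace ℚ K ((α : K) * l)) := by
    rw [mul_comm, ← hz]
    exact Algebra.isIntegral_trace (RingOfIntegers.isIntegral_coe z)
  obtain ⟨n, hn⟩ := IsIntegrallyClosed.isIntegral_iff.mp hint
  rw [mul_add, map_add, Rat.cast_add, ← hn]
  simp only [algebraMap_int_eq, eq_intCast, Rat.cast_intCast]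
  exact Literature.NumberTheory.LFunctions.VdC.e_add_int _ n

end Lattice

/-! ## The additive large sieve over a totally real field -/

section Main

open Module IsDedekindDomain
open scoped Classical nonZeroDivisors

variable (K : Type*) [Field K] [NumberField K] [IsTotallyReal K]

/-- The left-hand side of the large sieve in real coordinates: replacing `κ` by a representative
`κ − λ` (`λ ∈ 𝔞⁻¹`) and centring the box changes `∑_α c(α) e(Tr(ακ))` by a unimodular factor only.
[folklore] -/
theorem norm_sum_e_trace_eq {𝔞 : Ideal (𝓞 K)} (h𝔞 : 𝔞 ≠ ⊥) {S : Finset (𝓞 K)} (hS : ∀ α ∈ S, α ∈ 𝔞)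
    (c : 𝓞 K → ℂ) (cen : {w : InfinitePlace K // w.IsReal} → ℝ) (κ : K) {l : K}
    (hl : l ∈ ((𝔞 : FractionalIdeal (𝓞 K)⁰ K))⁻¹) :
    ‖∑ α ∈ S, c α * e ((Algebra.trace ℚ K ((α : K) * κ) : ℚ) : ℝ)‖ =
      ‖∑ α ∈ S, c α * e (∑ k, (remb K (α : K) k - cen k) * remb K (κ - l) k)‖ := by
  have hθ : ∀ α ∈ S, e ((Algebra.trace ℚ K ((α : K) * κ) : ℚ) : ℝ) =
      e (∑ k, (remb K (α : K) k - cen k) * remb K (κ - l) k) * e (∑ k, cen k * remb K (κ - l) k) := by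
    intro α hα
    have h1 : (α : K) * κ = (α : K) * ((κ - l) + l) := by ring
    rw [h1, e_trace_mul_add_of_mem_inv K h𝔞 (hS α hα) hl, e_trace, ← e_add, ← Finset.sum_add_distrib]
    congr 1
    refine Finset.sum_congr rfl fun k _ => ?_
    rw [remb_mul, Pi.mul_apply]; ring
  have h2 : ∑ α ∈ S, c α * e ((Algebra.trace ℚ K ((α : K) * κ) : ℚ) : ℝ) =
      (∑ α ∈ S, c α * e (∑ k, (remb K (α : K) k - cen k) * remb K (κ - l) k)) *
        e (∑ k, cen k * remb K (κ - l) k) := by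
    rw [Finset.sum_mul]
    refine Finset.sum_congr rfl fun α hα => ?_
    rw [hθ α hα, mul_assoc]
  rw [h2, norm_mul, norm_e, mul_one]

omit [NumberField K] [IsTotallyReal K] in
/-- Bookkeeping of the constants in the large sieve. [folklore] -/
theorem constant_bookkeeping {d : ℕ} {P₁ P₂ P₃ M A B L : ℝ} (hA : 0 ≤ A) (hL : 0 ≤ L)
    (hP₁ : 0 ≤ P₁) (hB0 : 0 ≤ B) (h1 : P₁ ≤ M ^ d * P₂) (h2 : B ≤ 2 ^ d * P₃) :
    (624 : ℝ) ^ d * P₁ * A * B * L ≤ (624 ^ d * M ^ d * A * 2 ^ d) * (P₂ * P₃) * L := by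
  refine mul_le_mul_of_nonneg_right ?_ hL
  have hMP : 0 ≤ M ^ d * P₂ := hP₁.trans h1
  calc (624 : ℝ) ^ d * P₁ * A * B ≤ 624 ^ d * (M ^ d * P₂) * A * (2 ^ d * P₃) := by
        refine mul_le_mul ?_ h2 hB0 (by positivity)
        exact mul_le_mul_of_nonneg_right (mul_le_mul_of_nonneg_left h1 (by positivity)) hA
    _ = (624 ^ d * M ^ d * A * 2 ^ d) * (P₂ * P₃) := by ring

/-- **The additive large sieve inequality for a totally real number field, sublattice form**
(Huxley 1968, Theorem 1, for `𝔞 = 𝓞_K`; Hinz 1987 = Hinz 1988 (3.1) in additive form).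
There is `C = C(K) > 0` such that for every nonzero ideal `𝔞`, every finite `S ⊆ 𝔞` inside a
box `|σ_w α − cen_w| ≤ X_w` (`X_w > 0`), every `δ > 0`, every finite family `(κ_r)` of elements of
`K` which is `δ`-separated modulo `𝔞⁻¹` in the sup-norm — for `r ≠ r'` and every `λ ∈ 𝔞⁻¹` some
`|σ_w(κ_r − κ_{r'} − λ)| ≥ δ` — and all coefficients `c(α)`:

  `∑_r |∑_{α∈S} c(α) e(Tr(α κ_r))|² ≤ C ∏_w [(1 + X_w N𝔞^{-1/d})(1 + (δ X_w)⁻¹)] ∑_{α∈S} |c(α)|²`.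

With the Farey points `κ ∈ 𝔮⁻¹𝔡⁻¹/𝔡⁻¹` of exact denominator `𝔮`, `N𝔮 ≤ Q`, `(𝔮, 𝔞) = 1`
(`δ = (Q²N𝔞|d_K|)^{-1/d}`) and a balanced box of volume `≍ X₀^d` this is `≪_K (Q² + X₀^d/N𝔞) ∑|c|²`.
[cite: Hinz1988, §3 (3.1)] -/
theorem additiveLargeSieve : ∃ C : ℝ, 0 < C ∧ ∀ (𝔞 : Ideal (𝓞 K)), 𝔞 ≠ ⊥ → ∀ (S : Finset (𝓞 K)),
    (∀ α ∈ S, α ∈ 𝔞) → ∀ (cen X : {w : InfinitePlace K // w.IsReal} → ℝ), (∀ k, 0 < X k) →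
    (∀ α ∈ S, ∀ k, |remb K (α : K) k - cen k| ≤ X k) →
    ∀ {ρ' : Type*} (R : Finset ρ') (κ : ρ' → K) (δ : ℝ), 0 < δ →
    (∀ r ∈ R, ∀ r' ∈ R, r ≠ r' → ∀ l ∈ ((𝔞 : FractionalIdeal (𝓞 K)⁰ K))⁻¹,
      ∃ k, δ ≤ |remb K (κ r - κ r' - l) k|) →
    ∀ (c : 𝓞 K → ℂ),
    ∑ r ∈ R, ‖∑ α ∈ S, c α * e ((Algebra.trace ℚ K ((α : K) * κ r) : ℚ) : ℝ)‖ ^ 2 ≤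
      C * (∏ k, (1 + X k * (Ideal.absNorm 𝔞 : ℝ) ^ (-(1 / (finrank ℚ K : ℝ)))) * (1 + (δ * X k)⁻¹)) *
        ∑ α ∈ S, ‖c α‖ ^ 2 := by
  obtain ⟨C₃, hC₃, hrep⟩ := exists_mem_inv_remb_sub_le K
  set d : ℕ := finrank ℚ K with hd
  have hcard : Fintype.card {w : InfinitePlace K // w.IsReal} = d := card_realPlaces K
  set A : ℕ := (2 * ⌊(2 * C₃)⁻¹⌋₊ + 2) ^ d with hA
  set M : ℝ := max 1 C₃ with hM
  have hM1 : 1 ≤ M := le_max_left _ _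
  have hMC : C₃ ≤ M := le_max_right _ _
  refine ⟨624 ^ d * M ^ d * A * 2 ^ d, by positivity, ?_⟩
  intro 𝔞 h𝔞 S hS cen X hX hbox ρ' R κ δ hδ hsep c
  -- the scale `N = N𝔞^{-1/d}`
  have hN𝔞 : 0 < (Ideal.absNorm 𝔞 : ℝ) := by
    have : Ideal.absNorm 𝔞 ≠ 0 := by rwa [Ne, Ideal.absNorm_eq_zero_iff]
    positivity
  set N : ℝ := (Ideal.absNorm 𝔞 : ℝ) ^ (-(1 / (d : ℝ))) with hNdef
  have hN : 0 < N := Real.rpow_pos_of_pos hN𝔞 _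
  have hNinv : N⁻¹ = (Ideal.absNorm 𝔞 : ℝ) ^ (1 / (d : ℝ)) := by
    rw [hNdef, Real.rpow_neg hN𝔞.le, inv_inv]
  -- representatives of the `κ_r` modulo `𝔞⁻¹`
  choose l hl hlb using fun r => hrep 𝔞 h𝔞 (remb K (κ r))
  set y : ρ' → {w : InfinitePlace K // w.IsReal} → ℝ := fun r => remb K (κ r - l r) with hy
  set x : 𝓞 K → {w : InfinitePlace K // w.IsReal} → ℝ := fun α => remb K (α : K) - cen with hx
  set Y : {w : InfinitePlace K // w.IsReal} → ℝ := fun _ => C₃ * N with hY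
  have hYpos : ∀ k, 0 < Y k := fun k => by rw [hY]; positivity
  have hyb : ∀ r ∈ R, ∀ k, |y r k| ≤ Y k := by
    intro r _ k
    rw [hy, hY]; simp only
    rw [remb_sub, Pi.sub_apply]
    exact hlb r k
  have hxb : ∀ α ∈ S, ∀ k, |x α k| ≤ X k := fun α hα k => by rw [hx]; exact hbox α hα k
  -- neighbour bound on the lattice side
  have hAbd : ∀ α ∈ S, (S.filter fun α' => ∀ k, |x α k - x α' k| ≤ (2 * Y k)⁻¹).card ≤ A := by
    intro α _
    have h := card_filter_ideal_close_le K h𝔞 S hS (c := (2 * C₃)⁻¹) (by positivity) α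
    rw [← hd] at h
    have hfilt : (S.filter fun α' => ∀ k, |x α k - x α' k| ≤ (2 * Y k)⁻¹) =
        S.filter fun α' : 𝓞 K => ∀ w, |remb K (α : K) w - remb K (α' : K) w| ≤
          (2 * C₃)⁻¹ * (Ideal.absNorm 𝔞 : ℝ) ^ (1 / (d : ℝ)) := by
      refine Finset.filter_congr fun α' _ => ?_
      refine forall_congr' fun k => ?_
      have h1 : x α k - x α' k = remb K (α : K) k - remb K (α' : K) k := by
        rw [hx]; simp only [Pi.sub_apply]; ring
      have h2 : (2 * Y k)⁻¹ = (2 * C₃)⁻¹ * (Ideal.absNorm 𝔞 : ℝ) ^ (1 / (d : ℝ)) := by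
        rw [hY]; simp only; rw [← hNinv, ← mul_inv, mul_assoc]
      rw [h1, h2]
    rw [hfilt]
    exact h
  -- neighbour bound on the Farey side
  set B : ℕ := ∏ k : {w : InfinitePlace K // w.IsReal}, (2 * ⌊(2 * X k)⁻¹ / δ⌋₊ + 2) with hB
  have hysep : ∀ r ∈ R, ∀ r' ∈ R, r ≠ r' → ∃ k, δ ≤ |y r k - y r' k| := by
    intro r hr r' hr' hne
    have hmem : l r - l r' ∈ ((𝔞 : FractionalIdeal (𝓞 K)⁰ K))⁻¹ := Submodule.sub_mem _ (hl r) (hl r')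
    obtain ⟨k, hk⟩ := hsep r hr r' hr' hne (l r - l r') hmem
    refine ⟨k, ?_⟩
    rw [hy]; simp only
    rw [← Pi.sub_apply, ← remb_sub]
    have : κ r - l r - (κ r' - l r') = κ r - κ r' - (l r - l r') := by ring
    rwa [this]
  have hBbd : ∀ r ∈ R, (R.filter fun r' => ∀ k, |y r k - y r' k| ≤ (2 * X k)⁻¹).card ≤ B :=
    fun r _ => card_filter_close_le_of_separated R y hδ hysep (fun k => (2 * X k)⁻¹)
      (fun k => by have := hX k; positivity) r
  -- the discrete large sieve
  have hmain := discreteLargeSieve_of_neighbours S R x y c X Y hX hYpos hxb hyb hAbd hBbd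
  -- identify the left-hand sides
  have hLHS : ∀ r ∈ R, ‖∑ α ∈ S, c α * e ((Algebra.trace ℚ K ((α : K) * κ r) : ℚ) : ℝ)‖ =
      ‖∑ α ∈ S, c α * e (∑ k, x α k * y r k)‖ := fun r _ =>
    norm_sum_e_trace_eq K h𝔞 hS c cen (κ r) (hl r)
  rw [Finset.sum_congr rfl fun r hr => by rw [hLHS r hr]]
  refine hmain.trans ?_
  -- compare the constants
  have hS0 : 0 ≤ ∑ α ∈ S, ‖c α‖ ^ 2 := Finset.sum_nonneg fun _ _ => by positivity
  have hBle : (B : ℝ) ≤ 2 ^ d * ∏ k, (1 + (δ * X k)⁻¹) := by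
    have h1 := cast_prod_floor_le (fun k => (2 * X k)⁻¹) hδ (fun k => by have := hX k; positivity)
    refine h1.trans ?_
    rw [← hcard, ← Finset.card_univ, ← Finset.prod_const, ← Finset.prod_mul_distrib]
    refine Finset.prod_le_prod (fun k _ => by have := hX k; positivity) fun k _ => ?_
    have hXk := hX k
    have : 2 * ((2 * X k)⁻¹ / δ) = (δ * X k)⁻¹ := by field_simp
    rw [this]
    have : 0 ≤ (δ * X k)⁻¹ := by positivity
    linarith
  have hXYle : ∏ k, (1 + X k * Y k) ≤ M ^ d * ∏ k, (1 + X k * N) := by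
    rw [← hcard, ← Finset.card_univ, ← Finset.prod_const, ← Finset.prod_mul_distrib]
    refine Finset.prod_le_prod (fun k _ => by have := hX k; have := hYpos k; positivity) fun k _ => ?_
    rw [hY]; simp only
    have hXk := hX k
    have h1 : X k * (C₃ * N) ≤ M * (X k * N) := by
      rw [show X k * (C₃ * N) = C₃ * (X k * N) by ring]
      exact mul_le_mul_of_nonneg_right hMC (by positivity)
    have h2 : (1 : ℝ) ≤ M * 1 := by linarith
    linarith [mul_add M 1 (X k * N)]
  have hXY0 : 0 ≤ ∏ k, (1 + X k * Y k) :=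
    Finset.prod_nonneg fun k _ => by have := hX k; have := hYpos k; positivity
  rw [hcard, Finset.prod_mul_distrib]
  exact constant_bookkeeping (Nat.cast_nonneg A) hS0 hXY0 (Nat.cast_nonneg B) hXYle hBle

omit [NumberField K] [IsTotallyReal K] in
/-- `(1 + t)^d ≤ 2^d (1 + t^d)` for `t ≥ 0`. [folklore] -/
private theorem one_add_pow_le_two_pow_mul {t : ℝ} (ht : 0 ≤ t) (d : ℕ) : (1 + t) ^ d ≤ 2 ^ d * (1 + t ^ d) := by
  have h1 : 1 + t ≤ 2 * max 1 t := by
    have := le_max_left 1 t; have := le_max_right 1 t; linarith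
  have h2 : (max 1 t) ^ d ≤ 1 + t ^ d := by
    rcases le_total t 1 with h | h
    · rw [max_eq_left h, one_pow]; have : 0 ≤ t ^ d := by positivity
      linarith
    · rw [max_eq_right h]; linarith
  calc (1 + t) ^ d ≤ (2 * max 1 t) ^ d := pow_le_pow_left₀ (by linarith) h1 d
    _ = 2 ^ d * (max 1 t) ^ d := mul_pow _ _ _
    _ ≤ 2 ^ d * (1 + t ^ d) := mul_le_mul_of_nonneg_left h2 (by positivity)

/-- `(x^{-1/d})^d = x⁻¹` and `(x^{1/d})^d = x` for `x > 0`. [folklore] -/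
theorem rpow_neg_inv_pow {x : ℝ} (hx : 0 < x) {d : ℕ} (hd : 0 < d) :
    (x ^ (-(1 / (d : ℝ)))) ^ d = x⁻¹ ∧ (x ^ (1 / (d : ℝ))) ^ d = x := by
  have hd' : (d : ℝ) ≠ 0 := by exact_mod_cast hd.ne'
  constructor
  · rw [← Real.rpow_natCast, ← Real.rpow_mul hx.le, neg_mul, one_div_mul_cancel hd', Real.rpow_neg hx.le,
      Real.rpow_one]
  · rw [← Real.rpow_natCast, ← Real.rpow_mul hx.le, one_div_mul_cancel hd', Real.rpow_one]

/-- **The additive large sieve over a totally real field, cube form** (Huxley's Theorem 1 /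
Hinz's (3.1), additive version): there is `C = C(K) > 0` such that for every nonzero ideal `𝔞`,
every finite `S ⊆ 𝔞` in a cube `|σ_w α − cen_w| ≤ X₀` (`X₀ > 0`), every `T > 0`, every finite
family `(κ_r)` in `K` which is `(T N𝔞)^{-1/d}`-separated modulo `𝔞⁻¹` in the sup-norm, and all `c`,
`∑_r |∑_{α∈S} c(α)e(Tr(ακ_r))|² ≤ C (1 + X₀^d/N𝔞)(1 + T N𝔞/X₀^d) ∑|c(α)|²`.  For the Farey points
`N𝔮 ≤ Q`, `(𝔮, 𝔞) = 1` one has `T = Q²|d_K|`, and for `N𝔞 ≤ X₀^d`, `Q ≥ 1` the factor is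
`≤ 4C|d_K| (Q² + X₀^d/N𝔞)` — Huxley's `X + Q²` for `𝔞 = 𝓞_K`.
[cite: Huxley1968, Theorem 1] [cite: Hinz1988, §3 (3.1)] -/
theorem additiveLargeSieve_cube : ∃ C : ℝ, 0 < C ∧ ∀ (𝔞 : Ideal (𝓞 K)), 𝔞 ≠ ⊥ → ∀ (S : Finset (𝓞 K)),
    (∀ α ∈ S, α ∈ 𝔞) → ∀ (cen : {w : InfinitePlace K // w.IsReal} → ℝ) (X₀ : ℝ), 0 < X₀ →
    (∀ α ∈ S, ∀ k, |remb K (α : K) k - cen k| ≤ X₀) →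
    ∀ {ρ' : Type*} (R : Finset ρ') (κ : ρ' → K) (T : ℝ), 0 < T →
    (∀ r ∈ R, ∀ r' ∈ R, r ≠ r' → ∀ l ∈ ((𝔞 : FractionalIdeal (𝓞 K)⁰ K))⁻¹,
      ∃ k, (T * Ideal.absNorm 𝔞) ^ (-(1 / (finrank ℚ K : ℝ))) ≤ |remb K (κ r - κ r' - l) k|) →
    ∀ (c : 𝓞 K → ℂ),
    ∑ r ∈ R, ‖∑ α ∈ S, c α * e ((Algebra.trace ℚ K ((α : K) * κ r) : ℚ) : ℝ)‖ ^ 2 ≤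
      C * (1 + X₀ ^ finrank ℚ K / Ideal.absNorm 𝔞) * (1 + T * Ideal.absNorm 𝔞 / X₀ ^ finrank ℚ K) *
        ∑ α ∈ S, ‖c α‖ ^ 2 := by
  obtain ⟨C, hC, hLS⟩ := additiveLargeSieve K
  set d : ℕ := finrank ℚ K with hd
  have hd0 : 0 < d := finrank_pos
  refine ⟨C * (2 ^ d * 2 ^ d), by positivity, ?_⟩
  intro 𝔞 h𝔞 S hS cen X₀ hX₀ hbox ρ' R κ T hT hsep c
  have hN𝔞 : 0 < (Ideal.absNorm 𝔞 : ℝ) := by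
    have : Ideal.absNorm 𝔞 ≠ 0 := by rwa [Ne, Ideal.absNorm_eq_zero_iff]
    positivity
  set δ : ℝ := (T * Ideal.absNorm 𝔞) ^ (-(1 / (d : ℝ))) with hδ
  have hδ0 : 0 < δ := Real.rpow_pos_of_pos (by positivity) _
  have h := hLS 𝔞 h𝔞 S hS cen (fun _ => X₀) (fun _ => hX₀) hbox R κ δ hδ0 hsep c
  refine h.trans (mul_le_mul_of_nonneg_right ?_ (Finset.sum_nonneg fun _ _ => by positivity))
  -- the product over the places is a `d`-th power
  rw [Finset.prod_const, Finset.card_univ, card_realPlaces, ← hd, mul_pow]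
  set N : ℝ := (Ideal.absNorm 𝔞 : ℝ) ^ (-(1 / (d : ℝ))) with hN
  have hN0 : 0 < N := Real.rpow_pos_of_pos hN𝔞 _
  have hNd : N ^ d = (Ideal.absNorm 𝔞 : ℝ)⁻¹ := (rpow_neg_inv_pow hN𝔞 hd0).1
  have hδd : (δ⁻¹) ^ d = T * Ideal.absNorm 𝔞 := by
    rw [hδ, Real.rpow_neg (by positivity), inv_inv]
    exact (rpow_neg_inv_pow (by positivity : (0 : ℝ) < T * Ideal.absNorm 𝔞) hd0).2
  have h1 : (1 + X₀ * N) ^ d ≤ 2 ^ d * (1 + X₀ ^ d / Ideal.absNorm 𝔞) := by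
    refine (one_add_pow_le_two_pow_mul (by positivity) d).trans (le_of_eq ?_)
    rw [mul_pow, hNd, div_eq_mul_inv]
  have h2 : (1 + (δ * X₀)⁻¹) ^ d ≤ 2 ^ d * (1 + T * Ideal.absNorm 𝔞 / X₀ ^ d) := by
    refine (one_add_pow_le_two_pow_mul (by positivity) d).trans (le_of_eq ?_)
    rw [mul_inv, mul_pow, hδd, inv_pow, div_eq_mul_inv]
  have h3 : 0 ≤ (1 + X₀ * N) ^ d := by positivity
  calc C * ((1 + X₀ * N) ^ d * (1 + (δ * X₀)⁻¹) ^ d)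
      ≤ C * ((2 ^ d * (1 + X₀ ^ d / Ideal.absNorm 𝔞)) * (2 ^ d * (1 + T * Ideal.absNorm 𝔞 / X₀ ^ d))) := by
        refine mul_le_mul_of_nonneg_left (mul_le_mul h1 h2 (by positivity) (by positivity)) hC.le
    _ = C * (2 ^ d * 2 ^ d) * (1 + X₀ ^ d / Ideal.absNorm 𝔞) * (1 + T * Ideal.absNorm 𝔞 / X₀ ^ d) := by ring

end Main




end Literature.NumberTheory.Sieve.NumberFieldLS
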